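import Mathlib
import HarnessLib
import Literature.MathematicalPhysics.StatisticalMechanics.AbkmPackageNextHTwoKernel
import Literature.MathematicalPhysics.StatisticalMechanics.AbkmPackageSlotF4b2
import Literature.MathematicalPhysics.StatisticalMechanics.StepOperatorASecondDiffTorusFRD
import Literature.MathematicalPhysics.StatisticalMechanics.StepOperatorAKernelSecondDiff
import Literature.MathematicalPhysics.StatisticalMechanics.LinearisedMapOpB
import Literature.MathematicalPhysics.StatisticalMechanics.LinearisedMapABKMContraction

/-!
# [ABKM19] Lemma 12.6 at `ℓ = 2` for the extracted Hamiltonian: `‖ΔΔ_{y,z} H̃^{(q)}(u,v)‖_{k,0} ≤ ℓ_HH |y|₁|z|₁ max(‖u‖, c_v)`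
# with an `N`-FREE constant, for every package

The parallelogram (mixed second) difference in the tuning parameter of the extracted Hamiltonian
`H̃^{(q)} = A_k^{(q)}u + B_k^{(q)}v = nextH (abkmStepData L R k 𝒞s_q) (toHam u) (mulExt v)` of the renormalisation step:
the `ℓ = 2` twin of `AbkmPackageNextHTwoKernel.PackageData.exists_hamNorm_nextH_sub`.  Inputs: the `A`-part is affine in
the covariances `γ_q` (`StepOperatorAKernelSecondDiff.hamNorm_stepOpA_secondDiff_abkm_le`) and `L^{dk}|ΔΔγ| ≤ 4d⁴C₂|y|₁|z|₁`
(`abs_gradCov_secondDiff_le_of_torusFRD`); the `B`-part is the slot `F4b2` (`exists_f4b2_unif`, scale `k+1`, `N`-free)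
moved to the scale-`k` norm (`hamNorm_le_mul_hamNorm_succ_abkm`, cost `L^{⌊d/2⌋+1+2d} κ_L^{−2}`) and `B_k(mulExt v) = B_k v`
(`B_k` only sees the connected block `B₀`).

* `hamNorm_le_mul_hamNorm_succ_abkm` — `‖H‖_{k,0} ≤ L^{⌊d/2⌋+1+2d} κ_L^{−2} ‖H‖_{k+1,0}` (`κ_L = scaleRatio d L`);
* **`PackageData.exists_hamNorm_nextH_secondDiff`** — `∀ P, ∃ ℓ_HH ≥ 0, ∀ N M Q`, parallelograms `q, q+y, q+z, q+y+z` in the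
  ball, `k + 1 ≤ N`, `u`, `‖v‖_k ≤ c_v`:
  `‖H̃^{(q+y+z)} − H̃^{(q+y)} − H̃^{(q+z)} + H̃^{(q)}‖_{k,0} ≤ ℓ_HH |y|₁ |z|₁ max(‖u‖, c_v)`.

This is input (i) of the plan for the stub `stub_f4l2ShrinkLoc` (`F4l2ShrinkLoc 4`) of the line `banach_two_kernel` of the
child `TwoKernelSkBound` of the cruxes `HypACumulant` / `HypALocalTwoPoint`
(route `Summits/HubbardSuperconductivity/…/Theses/ComplexGFFStiffness`; crux memo TWOKERNEL-PLAN-27414-v2 §9, term B1).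
Honest scope: nothing about superconductivity in the Hubbard model.  Everything is proved; no named fact.

## References
* S. Adams, S. Buchholz, R. Kotecký, S. Müller, arXiv:1910.13564 — Theorem 6.8 (6.55)–(6.57), Lemma 10.6 (10.41),
  Lemma 12.6 (12.51)–(12.53) at `ℓ = 2` [AdamsBuchholzKoteckyMuller2019].
-/

noncomputable section

namespace Literature.MathematicalPhysics.StatisticalMechanics.GradientRG

open scoped BigOperators Classical
open Finset
open Literature.MathematicalPhysics.StatisticalMechanics.TorusPolymer (IsPolymer numBlocks blockOf boxCorner thicken)
open Literature.Barriers.CriticalPhenomena.LongRangePhi4.Polymer (IsConn)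
open Literature.MathematicalPhysics.QuantumFieldTheory

variable {d : ℕ}

/-! ## Scale change `k+1 → k` of the coefficient norm -/

/-- **`‖H‖_{k,0} ≤ L^{⌊d/2⌋+1+2d} κ_L^{−2} ‖H‖_{k+1,0}`** (`d ≥ 3`, `L ≥ 4`, `κ_L = scaleRatio d L ≤ 1`): the torus
coefficient norm of scale `k` is dominated by the one of scale `k+1` with an `N`-free constant (the constant
coefficient gains `L^{−d}`, a linear one `|α| ≤ ⌊d/2⌋+1` costs `L^{|α|}/(L^dκ_L)`, a quadratic one `L²/(L^dκ_L²)`).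
[cite: AdamsBuchholzKoteckyMuller2019, Lemma 10.6 (10.41) / Ch. 6.4 (6.40)] -/
theorem hamNorm_le_mul_hamNorm_succ_abkm {𝕜 : Type*} [NormedField 𝕜] [NormedAlgebra ℝ 𝕜] (hd : 3 ≤ d) {L : ℕ}
    (hL4 : 4 ≤ L) {h : ℝ} (hh : 0 < h) (k : ℕ) (H : RelevantHamiltonian 𝕜 d) :
    hamNorm (fieldWt h L d k) ((L : ℝ) ^ k) (L ^ (d * k)) H ≤
      ((L : ℝ) ^ (d / 2 + 1 + 2 * d) * (scaleRatio d L)⁻¹ ^ 2) *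
        hamNorm (fieldWt h L d (k + 1)) ((L : ℝ) ^ (k + 1)) (L ^ (d * (k + 1))) H := by
  have hLpos : 0 < L := by omega
  have hL1 : (1 : ℝ) ≤ L := by exact_mod_cast (show 1 ≤ L by omega)
  have hL0 : (0 : ℝ) < L := by linarith
  set sR := scaleRatio d L with hsRdef
  have hsR0 : 0 < sR := scaleRatio_pos hLpos
  have hsR1 : sR ≤ 1 := scaleRatio_le_one hd hL4
  have hsRi : 1 ≤ sR⁻¹ := (one_le_inv₀ hsR0).2 hsR1
  set 𝔥k := fieldWt h (L : ℝ) d k with h𝔥kdef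
  have h𝔥k : 0 < 𝔥k := fieldWt_pos hh hL0 d k
  have hsucc : fieldWt h (L : ℝ) d (k + 1) = sR * 𝔥k := fieldWt_succ_nat hLpos d k
  set c := (L : ℝ) ^ (d / 2 + 1 + 2 * d) * sR⁻¹ ^ 2 with hcdef
  have e2 : (L : ℝ) ^ (d * (k + 1)) = (L : ℝ) ^ (d * k) * (L : ℝ) ^ d := by
    rw [Nat.mul_succ, pow_add]
  have hLd1 : (1 : ℝ) ≤ (L : ℝ) ^ d := one_le_pow₀ hL1
  refine hamNorm_le_mul_of_weights ?_ (fun α => ?_) ?_ H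
  · -- the constant coefficient
    push_cast
    rw [e2, show c * ((L : ℝ) ^ (d * k) * (L : ℝ) ^ d) = (c * (L : ℝ) ^ d) * (L : ℝ) ^ (d * k) by ring]
    refine le_mul_of_one_le_left (by positivity) ?_
    have h1 : (1 : ℝ) ≤ (L : ℝ) ^ (d / 2 + 1 + 2 * d) := one_le_pow₀ hL1
    have h2 : (1 : ℝ) ≤ sR⁻¹ ^ 2 := one_le_pow₀ hsRi
    have : (1 : ℝ) ≤ c := one_le_mul_of_one_le_of_one_le h1 h2
    exact one_le_mul_of_one_le_of_one_le this hLd1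
  · -- a linear coefficient, `|α| ≤ ⌊d/2⌋ + 1`
    set a := ∑ i, (α : Fin d → ℕ) i with hadef
    have ha : a ≤ d / 2 + 1 := (mem_linIndex.1 α.2).2
    push_cast
    rw [hsucc, e2]
    have e1 : ((L : ℝ) ^ (k + 1)) ^ a = (L : ℝ) ^ a * ((L : ℝ) ^ k) ^ a := by
      rw [pow_succ, mul_pow, mul_comm]
    rw [e1, mul_inv]
    rw [show c * ((L : ℝ) ^ (d * k) * (L : ℝ) ^ d * (sR * 𝔥k * (((L : ℝ) ^ a)⁻¹ * (((L : ℝ) ^ k) ^ a)⁻¹))) =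
        (c * (L : ℝ) ^ d * sR * ((L : ℝ) ^ a)⁻¹) * ((L : ℝ) ^ (d * k) * (𝔥k * (((L : ℝ) ^ k) ^ a)⁻¹)) by ring]
    refine le_mul_of_one_le_left (by positivity) ?_
    have hLa : (0 : ℝ) < (L : ℝ) ^ a := by positivity
    have h1 : (1 : ℝ) ≤ (L : ℝ) ^ (d / 2 + 1 + 2 * d) * ((L : ℝ) ^ a)⁻¹ := by
      rw [← div_eq_mul_inv, one_le_div hLa]
      exact pow_le_pow_right₀ hL1 (by omega)
    have h2 : (1 : ℝ) ≤ sR⁻¹ ^ 2 * sR := by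
      rw [pow_two, mul_assoc, inv_mul_cancel₀ hsR0.ne', mul_one]; exact hsRi
    calc (1 : ℝ) ≤ ((L : ℝ) ^ (d / 2 + 1 + 2 * d) * ((L : ℝ) ^ a)⁻¹) * (L : ℝ) ^ d :=
          one_le_mul_of_one_le_of_one_le h1 hLd1
      _ ≤ ((L : ℝ) ^ (d / 2 + 1 + 2 * d) * ((L : ℝ) ^ a)⁻¹) * (L : ℝ) ^ d * (sR⁻¹ ^ 2 * sR) :=
          le_mul_of_one_le_right (by positivity) h2
      _ = c * (L : ℝ) ^ d * sR * ((L : ℝ) ^ a)⁻¹ := by rw [hcdef]; ring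
  · -- a quadratic coefficient
    push_cast
    rw [hsucc, e2]
    have e3 : (sR * 𝔥k / (L : ℝ) ^ (k + 1)) ^ 2 = sR ^ 2 * ((L : ℝ) ^ 2)⁻¹ * (𝔥k / (L : ℝ) ^ k) ^ 2 := by
      field_simp
      ring
    rw [e3, show c * ((L : ℝ) ^ (d * k) * (L : ℝ) ^ d * (sR ^ 2 * ((L : ℝ) ^ 2)⁻¹ * (𝔥k / (L : ℝ) ^ k) ^ 2)) =
        (c * (L : ℝ) ^ d * sR ^ 2 * ((L : ℝ) ^ 2)⁻¹) * ((L : ℝ) ^ (d * k) * (𝔥k / (L : ℝ) ^ k) ^ 2) by ring]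
    refine le_mul_of_one_le_left (by positivity) ?_
    have hL2 : (0 : ℝ) < (L : ℝ) ^ 2 := by positivity
    have h1 : (1 : ℝ) ≤ (L : ℝ) ^ (d / 2 + 1 + 2 * d) * ((L : ℝ) ^ 2)⁻¹ := by
      rw [← div_eq_mul_inv, one_le_div hL2]
      exact pow_le_pow_right₀ hL1 (by omega)
    have h2 : sR⁻¹ ^ 2 * sR ^ 2 = 1 := by
      rw [← mul_pow, inv_mul_cancel₀ hsR0.ne', one_pow]
    calc (1 : ℝ) ≤ ((L : ℝ) ^ (d / 2 + 1 + 2 * d) * ((L : ℝ) ^ 2)⁻¹) * (L : ℝ) ^ d :=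
          one_le_mul_of_one_le_of_one_le h1 hLd1
      _ = ((L : ℝ) ^ (d / 2 + 1 + 2 * d) * ((L : ℝ) ^ 2)⁻¹) * (L : ℝ) ^ d * (sR⁻¹ ^ 2 * sR ^ 2) := by
          rw [h2, mul_one]
      _ = c * (L : ℝ) ^ d * sR ^ 2 * ((L : ℝ) ^ 2)⁻¹ := by rw [hcdef]; ring

namespace PackageData

set_option maxHeartbeats 1600000 in
/-- **`ΔΔ_{y,z} H̃^{(q)}` has an `N`-free bilinear size, every package** (module docstring).
[cite: AdamsBuchholzKoteckyMuller2019, Lemma 12.6 (12.51)–(12.52) at ℓ = 2 / Theorem 6.8 (6.55)–(6.57)] -/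
theorem exists_hamNorm_nextH_secondDiff (P : PackageData d) [Fact (0 < P.h)] [Fact (0 < P.L)] :
    ∃ ℓHH : ℝ, 0 ≤ ℓHH ∧ ∀ (N M : ℕ) [NeZero M] (Q : PackageAt P N M) (q y z : Matrix (Fin d) (Fin d) ℝ),
      P.InBall q → P.InBall (q + y) → P.InBall (q + z) → P.InBall (q + y + z) → ∀ k, k + 1 ≤ N →
      ∀ (u : HamSpace ℂ d (fieldWt P.h (P.L : ℝ) d k) ((P.L : ℝ) ^ k) (P.L ^ (d * k)))
        (v : activitySpace Q.normParams k) (cv : ℝ), activityNormLE Q.normParams k v cv →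
        hamNorm (fieldWt P.h (P.L : ℝ) d k) ((P.L : ℝ) ^ k) (P.L ^ (d * k))
          (nextH (abkmStepData P.L P.R k (Q.kernels (q + y + z))) (HamSpace.toHam u)
              (mulExt ((v : activitySpace Q.normParams k) :
                Finset (Fin d → ZMod M) → ((Fin d → ZMod M) → ℝ) → ℂ)) -
            nextH (abkmStepData P.L P.R k (Q.kernels (q + y))) (HamSpace.toHam u)
              (mulExt ((v : activitySpace Q.normParams k) :
                Finset (Fin d → ZMod M) → ((Fin d → ZMod M) → ℝ) → ℂ)) -
            nextH (abkmStepData P.L P.R k (Q.kernels (q + z))) (HamSpace.toHam u)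
              (mulExt ((v : activitySpace Q.normParams k) :
                Finset (Fin d → ZMod M) → ((Fin d → ZMod M) → ℝ) → ℂ)) +
            nextH (abkmStepData P.L P.R k (Q.kernels q)) (HamSpace.toHam u)
              (mulExt ((v : activitySpace Q.normParams k) :
                Finset (Fin d → ZMod M) → ((Fin d → ZMod M) → ℝ) → ℂ))) ≤
          ℓHH * esum y * esum z * max ‖u‖ cv := by
  -- the constants
  obtain ⟨bTT, hbTT0, hF4b2⟩ := exists_f4b2_unif P
  set C₂ := secondDiffConst (fun α => P.Cα α 2) with hC₂
  have hC₂0 : 0 ≤ C₂ := secondDiffConst_nonneg _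
  have hh0 : 0 < P.h := P.hh
  have h8 : 8 ≤ 2 ^ (d + 3) := by
    calc 8 = 2 ^ 3 := by norm_num
      _ ≤ 2 ^ (d + 3) := Nat.pow_le_pow_right (by norm_num) (by omega)
  have hL4 : 4 ≤ P.L := by have := P.hL; omega
  set cL := (P.L : ℝ) ^ (d / 2 + 1 + 2 * d) * (scaleRatio d P.L)⁻¹ ^ 2 with hcL
  have hcL0 : 0 ≤ cL := by positivity
  set ℓHH := 4 * ((d : ℝ) ^ 4 * C₂) / P.h ^ 2 + cL * bTT with hℓHH
  have hℓHH0 : 0 ≤ ℓHH := by positivity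
  refine ⟨ℓHH, hℓHH0, ?_⟩
  intro N M _ Q q y z hq hqy hqz hqyz k hk u v cv hv
  -- sizes
  have hd2 : 2 ≤ d := le_trans (by norm_num) P.hd
  have hL1 : 1 ≤ P.L := P.hLodd.pos
  have hpR : P.pT ≤ P.R := by have := P.hpM; have := P.hMR; omega
  have hPA : 0 < Q.normParams.A := P.A_pos
  have hMt : M = Q.normParams.L ^ k * P.L ^ (N - k) := by
    show M = P.L ^ k * P.L ^ (N - k)
    rw [Q.hM, ← pow_add, Nat.add_sub_cancel' (by omega)]
  have hcv0 : 0 ≤ cv := nonneg_of_weakNormLE hPA hMt P.hLodd.pow P.hLodd.pow hv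
  set H := HamSpace.toHam u with hHdef
  set Kf := mulExt ((v : activitySpace Q.normParams k) :
    Finset (Fin d → ZMod M) → ((Fin d → ZMod M) → ℝ) → ℂ) with hKfdef
  have hnormu : hamNorm (fieldWt P.h (P.L : ℝ) d k) ((P.L : ℝ) ^ k) (P.L ^ (d * k)) H = ‖u‖ := by
    rw [hHdef, HamSpace.norm_def]
  -- the four step data
  set D₁₁ := abkmStepData P.L P.R k (Q.kernels (q + y + z)) with hD₁₁
  set D₁₀ := abkmStepData P.L P.R k (Q.kernels (q + y)) with hD₁₀
  set D₀₁ := abkmStepData P.L P.R k (Q.kernels (q + z)) with hD₀₁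
  set D₀₀ := abkmStepData P.L P.R k (Q.kernels q) with hD₀₀
  have hpsd : ∀ {q₀ : Matrix (Fin d) (Fin d) ℝ}, P.InBall q₀ →
      (Matrix.circulant (abkmStepData P.L P.R k (Q.kernels q₀)).𝒞).PosSemidef := fun hq₀ =>
    (stepKernelBounds_family_of_torusFRD P.hd P.hMord P.hMR P.hLodd P.hL P.hθbar P.hlam P.hn P.hn2
      P.hnñ P.hc P.hC1 Q.hallA Q.hB P.hθ0 P.hθ P.hT₀ P.hKT₀ hq₀.1 hq₀.2 k hk).posSemidef
  -- the reference block has room for the test polynomials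
  obtain ⟨t, ht⟩ : ∃ t, N = k + t := ⟨N - k, by omega⟩
  have hMt0 : M = P.L ^ k * P.L ^ t := by rw [← pow_add, ← ht]; exact Q.hM
  have hB₀ : D₀₀.B₀ = blockOf (P.L ^ k) 0 := rfl
  have hc₀ : D₀₀.c₀ = boxCorner (P.L ^ k) (starRad P.R P.L d k) 0 := rfl
  have hBne : D₀₀.B₀.card ≠ 0 := by
    rw [hB₀]; exact (card_pos.2 ⟨0, TorusPolymer.mem_blockOf_self _ 0⟩).ne'
  obtain ⟨hwrap0, hroom0⟩ := abkm_box_lt (d := d) P.hL hpR hk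
  have hwrap : 4 * ((P.L ^ k - 1) / 2 + starRad P.R P.L d k) < M := by rw [Q.hM]; exact hwrap0
  have hroomB : ∀ x ∈ D₀₀.B₀, HasRoom D₀₀.c₀ x (d / 2 + 1) := by
    intro x hx
    have hxS : x ∈ thicken (starRad P.R P.L d k) (blockOf (P.L ^ k) 0) := by
      rw [← hB₀]; exact TorusPolymer.subset_thicken _ _ hx
    have hin := (TorusPolymer.mem_thicken_blockOf_iff_inBox hMt0 P.hLodd.pow P.hLodd.pow hwrap 0 x).1 hxS
    rw [hc₀]
    refine TorusPolymer.hasRoom_of_inBox hin ?_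
    have h2 : ((2 * ((P.L ^ k - 1) / 2 + starRad P.R P.L d k) : ℕ) + ((d / 2 + 1 : ℕ) : ℤ)) * 2 < (M : ℤ) := by
      have : (2 * ((P.L ^ k - 1) / 2 + starRad P.R P.L d k) + (d / 2 + 1)) * 2 < M := by
        rw [Q.hM]; have := hroom0; have := P.hp; omega
      exact_mod_cast this
    exact_mod_cast h2
  -- `L^{dk}|ΔΔγ| ≤ 4 d⁴ C₂ |y|₁ |z|₁`
  have hδ0 : 0 ≤ 4 * ((d : ℝ) ^ 4 * C₂) * esum y * esum z := by
    have := entrySum_nonneg y; have := entrySum_nonneg z; unfold esum; positivity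
  have hγ : ∀ p : quadIndex d, ((P.L ^ (d * k) : ℕ) : ℝ) *
      |gradCov D₁₁.𝒞 p - gradCov D₁₀.𝒞 p - gradCov D₀₁.𝒞 p + gradCov D₀₀.𝒞 p| ≤
        4 * ((d : ℝ) ^ 4 * C₂) * esum y * esum z := by
    intro p
    have e : ((P.L ^ (d * k) : ℕ) : ℝ) = (P.L : ℝ) ^ ((k + 1 - 1) * d) := by
      rw [Nat.add_sub_cancel, mul_comm]; push_cast; rfl
    rw [e]
    exact abs_gradCov_secondDiff_le_of_torusFRD (fun A hA => (Q.hallA A hA).2.2.2.2.1) hd2 P.hn2 hL1 P.hT₀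
      (by omega) (by omega) p hq hqy hqz hqyz
  -- the `A`-part and the algebra `ΔΔH̃ = ΔΔA + ΔΔB`
  have hA := hamNorm_stepOpA_secondDiff_abkm_le (h := P.h) hd2 hL1 hh0 hδ0 k hγ H
  have hsplit : nextH D₁₁ H Kf - nextH D₁₀ H Kf - nextH D₀₁ H Kf + nextH D₀₀ H Kf =
      (stepOpA (gradCov D₁₁.𝒞) H - stepOpA (gradCov D₁₀.𝒞) H - stepOpA (gradCov D₀₁.𝒞) H +
          stepOpA (gradCov D₀₀.𝒞) H) +
        (opB D₁₁ Kf - opB D₁₀ Kf - opB D₀₁ Kf + opB D₀₀ Kf) := by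
    rw [nextH_eq D₁₁ (hpsd hqyz) hBne hroomB H Kf, nextH_eq D₁₀ (hpsd hqy) hBne hroomB H Kf,
      nextH_eq D₀₁ (hpsd hqz) hBne hroomB H Kf, nextH_eq D₀₀ (hpsd hq) hBne hroomB H Kf]
    abel
  -- the `B`-part: slot `F4b2` at scale `k+1`, `B_k (mulExt v) = B_k v`, then scale `k`
  have hMo : Odd M := by rw [Q.hM]; exact P.hLodd.pow
  have hconnB : IsConn (blockOf (P.L ^ k) (0 : Fin d → ZMod M)) := TorusPolymer.isConn_blockOf hMo P.hLodd.pow 0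
  have hKfB : Kf (blockOf (P.L ^ k) 0) =
      ((v : activitySpace Q.normParams k) : Finset (Fin d → ZMod M) → ((Fin d → ZMod M) → ℝ) → ℂ)
        (blockOf (P.L ^ k) 0) := by
    rw [hKfdef, mulExt_of_isConn hconnB]
  have hopB : ∀ q₀ : Matrix (Fin d) (Fin d) ℝ, opB (abkmStepData P.L P.R k (Q.kernels q₀)) Kf =
      opB (abkmStepData P.L P.R k (Q.kernels q₀))
        ((v : activitySpace Q.normParams k) : Finset (Fin d → ZMod M) → ((Fin d → ZMod M) → ℝ) → ℂ) := by
    intro q₀; unfold opB; rw [show (abkmStepData P.L P.R k (Q.kernels q₀)).B₀ = blockOf (P.L ^ k) 0 from rfl, hKfB]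
  have hB2 := hF4b2 N M Q q y z hq hqy hqz hqyz k hk v cv hv
  rw [packageAt_opB_apply_of_mem P Q hqyz hk, packageAt_opB_apply_of_mem P Q hqy hk,
    packageAt_opB_apply_of_mem P Q hqz hk, packageAt_opB_apply_of_mem P Q hq hk, ← map_sub, ← map_sub, ← map_add,
    HamSpace.norm_def, HamSpace.toHam_ofHam] at hB2
  have hBk : hamNorm (fieldWt P.h (P.L : ℝ) d k) ((P.L : ℝ) ^ k) (P.L ^ (d * k))
      (opB D₁₁ Kf - opB D₁₀ Kf - opB D₀₁ Kf + opB D₀₀ Kf) ≤ cL * (bTT * esum y * esum z * cv) := by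
    rw [hD₁₁, hD₁₀, hD₀₁, hD₀₀, hopB, hopB, hopB, hopB]
    exact (hamNorm_le_mul_hamNorm_succ_abkm P.hd hL4 hh0 k _).trans (mul_le_mul_of_nonneg_left hB2 hcL0)
  -- assembly
  have h𝔥 : 0 < fieldWt P.h (P.L : ℝ) d k := fieldWt_pos hh0 (by exact_mod_cast P.hLodd.pos) d k
  have hRk : (0 : ℝ) ≤ (P.L : ℝ) ^ k := by positivity
  rw [hsplit]
  refine (hamNorm_add_le h𝔥.le hRk _ _ _).trans ?_
  refine (add_le_add hA hBk).trans ?_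
  rw [hnormu]
  set m := max ‖u‖ cv with hm
  have hum : ‖u‖ ≤ m := le_max_left _ _
  have hcm : cv ≤ m := le_max_right _ _
  have hy0 : 0 ≤ esum y := entrySum_nonneg y
  have hz0 : 0 ≤ esum z := entrySum_nonneg z
  have h1 : 4 * ((d : ℝ) ^ 4 * C₂) * esum y * esum z / P.h ^ 2 * ‖u‖ ≤
      4 * ((d : ℝ) ^ 4 * C₂) / P.h ^ 2 * esum y * esum z * m := by
    have : 4 * ((d : ℝ) ^ 4 * C₂) * esum y * esum z / P.h ^ 2 * ‖u‖ =
        4 * ((d : ℝ) ^ 4 * C₂) / P.h ^ 2 * esum y * esum z * ‖u‖ := by ring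
    rw [this]
    exact mul_le_mul_of_nonneg_left hum (by positivity)
  have h2 : cL * (bTT * esum y * esum z * cv) ≤ cL * bTT * esum y * esum z * m := by
    have : cL * (bTT * esum y * esum z * cv) = cL * bTT * esum y * esum z * cv := by ring
    rw [this]
    exact mul_le_mul_of_nonneg_left hcm (by positivity)
  calc 4 * ((d : ℝ) ^ 4 * C₂) * esum y * esum z / P.h ^ 2 * ‖u‖ + cL * (bTT * esum y * esum z * cv)
      ≤ 4 * ((d : ℝ) ^ 4 * C₂) / P.h ^ 2 * esum y * esum z * m + cL * bTT * esum y * esum z * m :=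
        add_le_add h1 h2
    _ = ℓHH * esum y * esum z * m := by rw [hℓHH]; ring

end PackageData

end Literature.MathematicalPhysics.StatisticalMechanics.GradientRG

end
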